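import Summits.HodgeConjecture.HodgeConjecture.Theorems.PadicSemiregularLiftHodgeFermatVarietiesPairedOfLargePrimesSharp
import Summits.HodgeConjecture.HodgeConjecture.Theorems.PadicSemiregularLiftHodgeFermatVarietiesFibreOfBoundaryNat
import Literature.AlgebraicGeometry.HodgeTheory.FermatShiodaCondition
import HarnessLib

/-!
# A non-paired Hodge octuple at a level prime to `30` has a full `7`-fibre at its top non-even level — line `cancel-by-any-claim-lattice`, crux `HodgeFermatVarieties` (stmt-HodgeConjecture-1334)

Lead c4's programme G8 (classification of the Hodge octuples of `ℤ/m`, `(m, 30) = 1`, `49 ∤ m`: four pairs or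
Aoki's `σ_{7,A}`), stub G8-L2a `stub_fibre_of_top_level_eight` (THE LEVEL ANALYSIS, one dimension above the
sextuple file `…FibreOfTopLevel`). Setting: a Hodge character `α : Fin 8 → ℤ/m`, `(m, 30) = 1`, `49 ∤ m`; for a
level `M ∣ m` write `cnt_M(u) = #{i : level(αᵢ) = M, unit part of αᵢ = u}` (`αᵢ = (m/M)·⟨uᵢ⟩`, lead c2's
`unitPart_spec`). THEOREM: if `cnt_M` is not even while `cnt_{M'}` is even at every proper multiple `M'` of `M`,
then `M = 7n` with `7 ∤ n`, `n > 1`, and for some unit `b` mod `n` the whole fibre `{crt⁻¹(y, b) : y ∈ (ℤ/7)ˣ}`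
consists of unit parts of level-`M` entries of `α`.

Proof (Aoki's level analysis with the prime `7` at the boundary; every brick is a landed theorem of lead c2's
`PairedNull` files): Aoki's criterion at conductor `M` and the evenness above `M`
(`sum_level_eq_zero_of_criterion`) make `T = cnt_M` orthogonal to the odd primitive characters mod `M`; since `T`
is not even, the refined counting `even_of_oddNull'` leaves a prime `p ∣ M` without room, i.e. `p ≤ #supp T + 1 ≤ 9`;
every prime of `m` is at least `7`, so `p = 7`. This is SIMPLER than the sextuple case: there is no kill branch.
`49 ∤ m` gives `M = 7n`, `7 ∤ n`; `n = 1` is a prime level (`even_of_oddNull_prime`); the primes of `n` are at least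
`11 > #supp T + 1`, so the ℕ-valued dichotomy `stub_fibre_of_boundary_nat` (S16-L1, `p₀ = 7`) applies: `T` even
(excluded) or a full fibre of six units inside the support.

References: [Aoki1983] N. Aoki, Math. Ann. 266 (1983) 23–54, Thm. A′ (§7), Prop. 2.2, Prop. 6.1, Prop. 6.4.
-/

-- every sibling file of the line declares into `…CancelByAnyClaimLattice.PairedNull` from a differently named module
set_option linter.dupNamespace false

noncomputable section

open Finset
open Literature.AlgebraicGeometry.HodgeTheory Literature.AlgebraicGeometry.HodgeTheory.FermatCharacter

namespace Summit.HodgeConjecture.HodgeConjecture.Theorems.CancelByAnyClaimLattice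

namespace PairedNull

section TopLevelEight

variable {m : ℕ} [NeZero m] {α : Fin 8 → ZMod m}

/-- **The level analysis of the programme G8** (section-variable form; see the module docstring): for a Hodge
octuple `α` of `ℤ/m`, `(m, 30) = 1`, `49 ∤ m`, a level `M ∣ m` whose unit-part multiplicity is not even while every
proper multiple of `M` is even is `M = 7n`, `7 ∤ n`, `n > 1`, with a full fibre `{crt⁻¹(y, b) : y ∈ (ℤ/7)ˣ}` of unit
parts of level-`M` entries. [cite: Aoki1983, Thm. A′ (§7), Prop. 2.2, Prop. 6.4] -/
theorem fibre_of_top_level_eight (hm : m.Coprime 30) (h49 : ¬ 49 ∣ m) (h : IsHodge α)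
    {M : ℕ} (hMm : M ∣ m)
    (hne : ∃ v : ZMod M,
      #(univ.filter fun i : Fin 8 ↦ m / m.gcd (α i).val = M ∧ ((((α i).val / (m / M)) : ℕ) : ZMod M) = -v) ≠
      #(univ.filter fun i : Fin 8 ↦ m / m.gcd (α i).val = M ∧ ((((α i).val / (m / M)) : ℕ) : ZMod M) = v))
    (hIH : ∀ M' : ℕ, M' ∣ m → M ∣ M' → M' ≠ M → ∀ u : ZMod M',
      #(univ.filter fun i : Fin 8 ↦ m / m.gcd (α i).val = M' ∧ ((((α i).val / (m / M')) : ℕ) : ZMod M') = -u) =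
      #(univ.filter fun i : Fin 8 ↦ m / m.gcd (α i).val = M' ∧ ((((α i).val / (m / M')) : ℕ) : ZMod M') = u)) :
    ∃ (n : ℕ) (hc : Nat.Coprime 7 n), M = 7 * n ∧ 1 < n ∧ ∃ b : ZMod n, IsUnit b ∧
      ∀ y : (ZMod 7)ˣ, ∃ i : Fin 8, m / m.gcd (α i).val = 7 * n ∧
        ((((α i).val / (m / (7 * n))) : ℕ) : ZMod (7 * n)) = (ZMod.chineseRemainder hc).symm ((y : ZMod 7), b) := by
  classical
  have hm0 : m ≠ 0 := NeZero.ne m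
  have hM0 : M ≠ 0 := fun h0 ↦ hm0 (by rw [h0] at hMm; exact zero_dvd_iff.mp hMm)
  haveI : NeZero M := ⟨hM0⟩
  -- the multiplicity function of the level-`M` unit parts
  set cnt : ZMod M → ℕ := fun u ↦
    #(univ.filter fun i : Fin 8 ↦ m / m.gcd (α i).val = M ∧ ((((α i).val / (m / M)) : ℕ) : ZMod M) = u) with hcnt
  set T : ZMod M → ℂ := fun u ↦ (cnt u : ℂ) with hT
  have hTnat : ∀ u, ∃ k : ℕ, T u = k := fun u ↦ ⟨cnt u, rfl⟩
  have hnotev : ¬ ∀ u, T (-u) = T u := by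
    intro hev
    obtain ⟨v, hv⟩ := hne
    apply hv
    have := hev v
    simp only [hT, Nat.cast_inj] at this
    exact this
  have hspec : ∀ i, IsUnit ((((α i).val / (m / (m / m.gcd (α i).val)) : ℕ) : ZMod (m / m.gcd (α i).val))) ∧
      ((m / (m / m.gcd (α i).val) : ℕ) : ZMod m) *
        ((ZMod.val ((((α i).val / (m / (m / m.gcd (α i).val)) : ℕ) : ZMod (m / m.gcd (α i).val))) : ℕ) : ZMod m)
          = α i :=
    fun i ↦ unitPart_spec (α i)
  have hcastM : ∀ (L : ℕ) (_ : L = M) (y : ZMod m),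
      (ZMod.cast ((((y.val / (m / L)) : ℕ) : ZMod L)) : ZMod M) = (((y.val / (m / M)) : ℕ) : ZMod M) := by
    intro L hL y; subst hL; exact ZMod.cast_id _ _
  have hcast : ∀ (L M' : ℕ) (_ : L = M') (hMM' : M ∣ M') (y : ZMod m),
      (ZMod.cast ((((y.val / (m / L)) : ℕ) : ZMod L)) : ZMod M) =
        ZMod.castHom hMM' (ZMod M) ((((y.val / (m / M')) : ℕ) : ZMod M')) := by
    intro L M' hL hMM' y; subst hL; rfl
  have hTu : ∀ u, ¬ IsUnit u → T u = 0 := by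
    intro u hu
    simp only [hT, Nat.cast_eq_zero, hcnt, Finset.card_eq_zero, Finset.filter_eq_empty_iff]
    intro i _ hi
    apply hu
    have hdvd : M ∣ m / m.gcd (α i).val := by rw [hi.1]
    rw [← hi.2, ← hcastM _ hi.1 (α i)]
    exact ((hspec i).1).map (ZMod.castHom hdvd (ZMod M))
  set I : Finset (Fin 8) := univ.filter fun i : Fin 8 ↦ m / m.gcd (α i).val = M with hI
  have hsupp_img : (univ.filter fun u : ZMod M ↦ T u ≠ 0) =
      I.image fun i ↦ ((((α i).val / (m / M)) : ℕ) : ZMod M) := by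
    ext u
    rw [mem_filter, mem_image]
    simp only [mem_univ, true_and, hT, Nat.cast_ne_zero, hcnt]
    rw [Finset.card_ne_zero]
    constructor
    · rintro ⟨i, hi⟩
      rw [mem_filter] at hi
      exact ⟨i, by rw [hI, mem_filter]; exact ⟨mem_univ _, hi.2.1⟩, hi.2.2⟩
    · rintro ⟨i, hi, hiu⟩
      rw [hI, mem_filter] at hi
      exact ⟨i, by rw [mem_filter]; exact ⟨mem_univ _, hi.2, hiu⟩⟩
  have hsuppR : #(univ.filter fun u : ZMod M ↦ T u ≠ 0) ≤ 8 := by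
    rw [hsupp_img]
    exact card_image_le.trans ((card_le_univ I).trans (by rw [Fintype.card_fin]))
  -- every prime of `m` (hence of `M`) is at least `7`
  have hm7 : ∀ p ∈ m.primeFactors, 7 ≤ p := by
    intro p hp
    have hpP := Nat.prime_of_mem_primeFactors hp
    have hpm := Nat.dvd_of_mem_primeFactors hp
    have h2 : p ≠ 2 := by
      rintro rfl; exact absurd (Nat.Coprime.coprime_dvd_left hpm hm) (by norm_num)
    have h3 : p ≠ 3 := by
      rintro rfl; exact absurd (Nat.Coprime.coprime_dvd_left hpm hm) (by norm_num)
    have h5 : p ≠ 5 := by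
      rintro rfl; exact absurd (Nat.Coprime.coprime_dvd_left hpm hm) (by norm_num)
    have h4 : p ≠ 4 := by rintro rfl; exact absurd hpP (by decide)
    have h6 : p ≠ 6 := by rintro rfl; exact absurd hpP (by decide)
    have := hpP.two_le
    omega
  have hM7 : ∀ p ∈ M.primeFactors, 7 ≤ p := fun p hp ↦ hm7 p (Nat.mem_primeFactors.mpr
    ⟨Nat.prime_of_mem_primeFactors hp, (Nat.dvd_of_mem_primeFactors hp).trans hMm, hm0⟩)
  have hM5 : ∀ p ∈ M.primeFactors, 5 ≤ p := fun p hp ↦ le_trans (by norm_num) (hM7 p hp)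
  haveI : ∀ i, NeZero (m / m.gcd (α i).val) := fun i ↦ ⟨(level_pos (α i)).ne'⟩
  -- Aoki's criterion at conductor `M`: `T` is orthogonal to the odd primitive characters mod `M`
  have hTodd : ∀ χ : DirichletCharacter ℂ M, χ.Odd → χ.IsPrimitive → ∑ u : ZMod M, T u * χ u = 0 := by
    intro χ hχ hprim
    have key := h.aoki_criterion hMm hχ hprim (fun i ↦ m / m.gcd (α i).val) (fun i ↦ level_dvd (α i))
      (fun i ↦ ((((α i).val / (m / (m / m.gcd (α i).val)) : ℕ) : ZMod (m / m.gcd (α i).val))))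
      (fun i ↦ (hspec i).1) (fun i ↦ (hspec i).2.symm)
    have hone : (∏ p ∈ M.primeFactors, (1 - χ p)) = 1 := by
      refine Finset.prod_eq_one fun p hp ↦ ?_
      have hnu : ¬ IsUnit ((p : ℕ) : ZMod M) := by
        rw [ZMod.isUnit_iff_coprime]
        exact fun hc ↦ (Nat.prime_of_mem_primeFactors hp).one_lt.ne'
          (Nat.Coprime.eq_one_of_dvd hc (Nat.dvd_of_mem_primeFactors hp))
      rw [χ.map_nonunit hnu, sub_zero]
    have hA : (fun L : ℕ ↦ ((m.totient : ℂ) / (L.totient : ℂ)) * ∏ p ∈ L.primeFactors, (1 - χ p)) M ≠ 0 := by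
      show ((m.totient : ℂ) / (M.totient : ℂ)) * ∏ p ∈ M.primeFactors, (1 - χ p) ≠ 0
      rw [hone, mul_one]
      exact div_ne_zero (by exact_mod_cast (Nat.totient_pos.mpr (NeZero.pos m)).ne')
        (by exact_mod_cast (Nat.totient_pos.mpr (NeZero.pos M)).ne')
    have key' := sum_level_eq_zero_of_criterion χ hχ (fun i ↦ m / m.gcd (α i).val)
      (fun i ↦ (level_pos (α i)).ne')
      (fun i ↦ ((((α i).val / (m / (m / m.gcd (α i).val)) : ℕ) : ZMod (m / m.gcd (α i).val))))
      (fun L : ℕ ↦ ((m.totient : ℂ) / (L.totient : ℂ)) * ∏ p ∈ L.primeFactors, (1 - χ p)) hA key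
      (fun i ↦ ((((α i).val / (m / M)) : ℕ) : ZMod M)) (fun i hi ↦ hcastM _ hi (α i))
      (fun L i ↦ ((((α i).val / (m / L)) : ℕ) : ZMod L)) (fun L hML i hiL ↦ hcast _ L hiL hML (α i))
      (fun L ⟨i, hiL⟩ hML hLM u ↦ hIH L (hiL ▸ level_dvd (α i)) hML hLM u)
    rw [sum_comp_eq_sum_card_mul (univ.filter fun i : Fin 8 ↦ m / m.gcd (α i).val = M)
      (fun i ↦ ((((α i).val / (m / M)) : ℕ) : ZMod M)) (fun u ↦ (χ u)⁻¹)] at key'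
    simp only [Finset.filter_filter] at key'
    have hconj : starRingEnd ℂ (∑ u : ZMod M, T u * χ u) = 0 := by
      rw [map_sum, ← key']
      refine Finset.sum_congr rfl fun u _ ↦ ?_
      rw [map_mul, hT, Complex.conj_natCast, char_inv_eq_conj]
    have := congrArg (starRingEnd ℂ) hconj
    rwa [starRingEnd_self_apply, map_zero] at this
  -- the refined counting leaves a prime `p` of `M` without room, and `p = 7`
  have hbad : ∃ p ∈ M.primeFactors, ¬ (#(univ.filter fun u : ZMod M ↦ T u ≠ 0) + 1 < p ∨
      (p = M.minFac ∧ p * p ∣ M ∧ #(univ.filter fun u : ZMod M ↦ T u ≠ 0) < p)) := by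
    by_contra hgood
    push Not at hgood
    exact hnotev (even_of_oddNull' hM5 T hTu hTodd fun p hp ↦ by
      have := hgood p hp; tauto)
  obtain ⟨p, hpmem, hpbad⟩ := hbad
  have hp : p.Prime := Nat.prime_of_mem_primeFactors hpmem
  have hpM : p ∣ M := Nat.dvd_of_mem_primeFactors hpmem
  have hp7 : 7 ≤ p := hM7 p hpmem
  have hple : p ≤ #(univ.filter fun u : ZMod M ↦ T u ≠ 0) + 1 := by
    by_contra hlt; exact hpbad (Or.inl (by omega))
  have hp9 : p ≤ 9 := by omega
  have hp8 : p ≠ 8 := by rintro rfl; exact absurd hp (by decide)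
  have hp9' : p ≠ 9 := by rintro rfl; exact absurd hp (by decide)
  obtain rfl : p = 7 := by omega
  /- `p = 7`: `M = 7 n`, `7 ∤ n`, `n > 1`, primes of `n` ≥ 11, and the ℕ-valued dichotomy -/
  have h49M : ¬ 49 ∣ M := fun h' ↦ h49 (h'.trans hMm)
  obtain ⟨n, rfl⟩ := hpM
  have hn0 : n ≠ 0 := fun h0 ↦ hM0 (by rw [h0, mul_zero])
  haveI : NeZero n := ⟨hn0⟩
  have h7n : ¬ 7 ∣ n := fun hd ↦ h49M (by obtain ⟨k, rfl⟩ := hd; exact ⟨k, by ring⟩)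
  have h7 : Nat.Prime 7 := by decide
  have hc : Nat.Coprime 7 n := (Nat.Prime.coprime_iff_not_dvd h7).mpr h7n
  have hn1 : n ≠ 1 := by
    intro hn1
    subst hn1
    exact hnotev (even_of_oddNull_prime (by rw [mul_one]; decide) T hTu hTodd)
  have hn5 : ∀ p' ∈ n.primeFactors, 5 ≤ p' := fun p' hp' ↦ hM5 p' (by
    rw [Nat.primeFactors_mul (by norm_num) hn0]; exact mem_union_right _ hp')
  have hn11 : ∀ p' ∈ n.primeFactors, 11 ≤ p' := by
    intro p' hp'
    have hp'P := Nat.prime_of_mem_primeFactors hp'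
    have hp'n := Nat.dvd_of_mem_primeFactors hp'
    have h7' := hM7 p' (by rw [Nat.primeFactors_mul (by norm_num) hn0]; exact mem_union_right _ hp')
    have hne7 : p' ≠ 7 := fun he ↦ h7n (he ▸ hp'n)
    have hne8 : p' ≠ 8 := by rintro rfl; exact absurd hp'P (by decide)
    have hne9 : p' ≠ 9 := by rintro rfl; exact absurd hp'P (by decide)
    have hne10 : p' ≠ 10 := by rintro rfl; exact absurd hp'P (by decide)
    omega
  have hroom : ∀ p' ∈ n.primeFactors, #(univ.filter fun u : ZMod (7 * n) ↦ T u ≠ 0) + 1 < p' := by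
    intro p' hp'; have := hn11 p' hp'; omega
  rcases stub_fibre_of_boundary_nat 7 n h7 (by norm_num) h7n hn5 hc T hTnat hTu hTodd hroom with
    hev | ⟨b, hbu, hfib⟩
  · exact absurd hev hnotev
  refine ⟨n, hc, rfl, by omega, b, hbu, fun y ↦ ?_⟩
  have hne0 : cnt ((ZMod.chineseRemainder hc).symm ((y : ZMod 7), b)) ≠ 0 := by
    have := hfib y
    simpa only [hT, Nat.cast_ne_zero] using this
  obtain ⟨i, hi⟩ := Finset.card_ne_zero.mp hne0
  rw [mem_filter] at hi
  exact ⟨i, hi.2.1, hi.2.2⟩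

end TopLevelEight

/-- **G8-L2a `stub_fibre_of_top_level_eight` — THE LEVEL ANALYSIS FOR OCTUPLES** (registered form of `fibre_of_top_level_eight`). [cite: Aoki1983, Thm. A′ (§7), Prop. 2.2, Prop. 6.4] -/
theorem stub_fibre_of_top_level_eight : ∀ {m : ℕ} [NeZero m] {α : Fin 8 → ZMod m}, m.Coprime 30 → ¬ 49 ∣ m → FermatCharacter.IsHodge α → ∀ {M : ℕ}, M ∣ m → (∃ v : ZMod M, #(univ.filter fun i : Fin 8 ↦ m / m.gcd (α i).val = M ∧ ((((α i).val / (m / M)) : ℕ) : ZMod M) = -v) ≠ #(univ.filter fun i : Fin 8 ↦ m / m.gcd (α i).val = M ∧ ((((α i).val / (m / M)) : ℕ) : ZMod M) = v)) → (∀ M' : ℕ, M' ∣ m → M ∣ M' → M' ≠ M → ∀ u : ZMod M', #(univ.filter fun i : Fin 8 ↦ m / m.gcd (α i).val = M' ∧ ((((α i).val / (m / M')) : ℕ) : ZMod M') = -u) = #(univ.filter fun i : Fin 8 ↦ m / m.gcd (α i).val = M' ∧ ((((α i).val / (m / M')) : ℕ) : ZMod M') = u)) → ∃ (n : ℕ)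 (hc : Nat.Coprime 7 n), M = 7 * n ∧ 1 < n ∧ ∃ b : ZMod n, IsUnit b ∧ ∀ y : (ZMod 7)ˣ, ∃ i : Fin 8, m / m.gcd (α i).val = 7 * n ∧ ((((α i).val / (m / (7 * n))) : ℕ) : ZMod (7 * n)) = (ZMod.chineseRemainder hc).symm ((y : ZMod 7), b) :=
  fun hm h49 h _ hMm hne hIH ↦ fibre_of_top_level_eight hm h49 h hMm hne hIH

end PairedNull

end Summit.HodgeConjecture.HodgeConjecture.Theorems.CancelByAnyClaimLattice

end
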